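import Literature.Geometry.Riemannian.ChangGurskyYangProofs
import Literature.Topology.FourManifolds.SimplyConnectedEulerCharacteristic
import HarnessLib

/-!
# Chang–Gursky–Yang 2003, Theorem A (vended special case): the Euler-characteristic step
# `(0.3) ⇔ (1.2)`, with `χ(M) ≥ 2` PROVED, and the reduction to the Chern–Gauss–Bonnet formula itself

Third companion ("Proofs") file of `Literature/Geometry/Riemannian/ChangGurskyYang.lean` (the named
fact `changGurskyYang_sphere_four`: a closed simply connected smooth 4-manifold with a metric of
`scal > 0` and Weyl energy `∫|W|² dV < 32π²` is diffeomorphic to `S⁴` — Chang–Gursky–Yang 2003,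
Thm. A, simply connected `scal > 0` case). `ChangGurskyYangProofs.lean` proves §2 of the paper as
the reduction `changGurskyYang_sphere_four_of_margerin_of_chernGaussBonnet_of_thm14` to three
hypotheses: Margerin 1998, Thm. 1 (`hMargerin`); Thm. 1.4 of the paper with `α = 1` (`hThm14`); and
`hCGB`, which bundled TWO classical results — the Chern–Gauss–Bonnet formula (1.1)
`8π² χ(M) = ¼∫|W|² + ∫σ₂(A)` and the topological fact `χ(M) ∈ ℕ`, `χ(M) ≥ 2` for closed simply
connected 4-manifolds — in the shape "there is `χ : ℕ`, `χ ≥ 2`, with `8π²χ = ¼∫|W|² + ∫σ₂(A)`",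
because at the time no Euler characteristic was available to the file.

The tree has the Euler characteristic of singular homology, `χ(M) = relEuler ℤ ℤ M ∅ =
Σ_k (−1)^k rank H_k(M; ℤ)` (`EulerCharacteristicTriple.lean`, Mathlib's `GradedObject.eulerChar`),
and now the THEOREM `χ(M) = 2 + b₂(M) ≥ 2` for closed simply connected topological 4-manifolds
(`Literature.Topology.FourManifolds.exists_nat_relEuler_eq_of_simplyConnectedSpace`,
`two_le_relEuler_of_simplyConnectedSpace`, `SimplyConnectedEulerCharacteristic.lean`: Hurewicz in
degree one, orientability of simply connected manifolds, Poincaré duality — all proved in the tree;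
Gompf–Stipsicz 1999, §1.2). This file uses it to split `hCGB` and DISCHARGE its topological half:

* `sixteen_pi_sq_le_of_chernGaussBonnet`, `quarter_weylEnergy_lt_of_chernGaussBonnet` — on a
  closed simply connected 4-manifold, the Chern–Gauss–Bonnet identity for `(M, g)` gives
  `16π² ≤ ¼∫|W|² + ∫σ₂(A)` and hence `∫|W|² < 32π² ⇒ ¼∫|W|² < ∫σ₂(A)` ((0.3) with `32π²` ⇒ (1.2));
* `weylEnergy_lt_iff_of_chernGaussBonnet` — Chang–Gursky–Yang 2003, §2, line 2 / p. 111: "the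
  assumption (0.3) is equivalent to the inequality (1.2)": given (1.1) for `(M, g)`,
  `∫|W|² < 16π² χ(M) ↔ ¼∫|W|² < ∫σ₂(A)` (any closed `M`);
* `changGurskyYang_theoremA_of_chernGaussBonnet_of_margerin_of_thm14` — **Theorem A AS PRINTED**
  (closed connected `M⁴`, `Y(M,[g]) > 0`, `∫|W|² dV < 16π² χ(M)` ⇒ `S⁴` or `ℝP⁴`), now statable
  with `χ(M) = relEuler ℤ ℤ M ∅`, proved as in §2 from the three hypotheses below;
  `changGurskyYang_sphere_four_of_theoremA` — the vended special case follows from Theorem A as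
  printed, the three auxiliary classical facts of the fact file's docstring being THEOREMS of the
  tree (`Y > 0` from `scal > 0`, `χ(M) ≥ 2`, `π₁(ℝP⁴) ≠ 1`): nothing stronger than Theorem A is
  vendored;
* `changGurskyYang_sphere_four_of_chernGaussBonnet_of_margerin_of_thm14` — Theorem A (vended special
  case) from THREE hypotheses each of which is now ONE published theorem stated verbatim:
  `hCGB` = the Chern–Gauss–Bonnet formula (1.1) for closed smooth Riemannian 4-manifolds,
  `8π² χ(M) = ¼ (∫|W|² dV).toReal + ∫σ₂(A) dV` with `χ(M) = relEuler ℤ ℤ M ∅` (Besse 1987, 6.30–6.31;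
  Chern 1944); `hMargerin` = Margerin 1998, Thm. 1; `hThm14` = Chang–Gursky–Yang 2003, Thm. 1.4
  (`α = 1`). None of the three is a named fact of the tree (a proving seat may not mint facts,
  D-0026); they are deep theorems — Chern–Weil theory with the de Rham/singular comparison, Ricci
  flow with weakly pinched curvature, the fully nonlinear elliptic theory of [CGY1] — and constitute
  the exact remaining proof debt of `changGurskyYang_sphere_four` along the printed line.

Everything here is proved; no definition and no named fact is introduced.

## References

* S.-Y. A. Chang, M. J. Gursky, P. C. Yang, *A conformally invariant sphere theorem in four
  dimensions*, Publ. Math. IHÉS 98 (2003) 105–143, Thm. A, (0.3)–(0.4) p. 107, (1.1)–(1.2) p. 111,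
  Thm. 1.4 pp. 112–113, §2 p. 121. [ChangGurskyYang2003]
* A. L. Besse, *Einstein Manifolds*, Springer 1987, 6.30–6.31 (`χ = Σ(−1)^i b_i`; the
  four-dimensional Chern–Gauss–Bonnet formula). [Besse1987]
* C. Margerin, *A sharp characterization of the smooth 4-sphere in curvature terms*, Comm. Anal.
  Geom. 6 (1998) 21–65, Thm. 1. [Margerin1998]
* R. Gompf, A. Stipsicz, *4-Manifolds and Kirby Calculus*, AMS 1999, §1.2 (`χ = 2 + b₂`).
  [GompfStipsicz1999]
-/

noncomputable section

open MeasureTheory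
open scoped Manifold ContDiff ENNReal

namespace Literature.Geometry.Riemannian

open Literature.Geometry.Lorentzian (PseudoRiemannianMetric riemannianMeasure)
open Literature.Geometry.Lorentzian.PseudoRiemannianMetric
open Literature.AlgebraicTopology.SingularHomology (relEuler)
open Literature.Topology.FourManifolds

section EulerStep

variable {M : Type} [TopologicalSpace M] [T2Space M] [SecondCountableTopology M]
  [ChartedSpace (EuclideanSpace ℝ (Fin 4)) M] [IsManifold (𝓡 4) ∞ M] [CompactSpace M]
  (g : PseudoRiemannianMetric (𝓡 4) ∞ (EuclideanSpace ℝ (Fin 4)) (TangentSpace (𝓡 4) : M → Type _))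
  [g.HasLeviCivita]

omit [SecondCountableTopology M] [CompactSpace M] in
/-- **"(0.3) is equivalent to the inequality (1.2)"** (Chang–Gursky–Yang 2003, §2, p. 121, line 2;
p. 111, "Using (1.1), assumption (0.5) of Theorem A′ can be expressed (1.2)"): if the
Chern–Gauss–Bonnet identity (1.1) `8π² χ(M) = ¼∫|W|² + ∫σ₂(A)` holds for `(M, g)`, then
`∫|W|² < 16π² χ(M) ↔ ¼∫|W|² < ∫σ₂(A)` (`16π²χ = ½∫|W|² + 2∫σ₂(A)`). Pure arithmetic; `χ(M)` is the
tree's `relEuler ℤ ℤ M ∅`. [cite: ChangGurskyYang2003, §2, p. 121] -/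
theorem weylEnergy_lt_iff_of_chernGaussBonnet
    (hCGB : 8 * Real.pi ^ 2 * (relEuler ℤ ℤ M ∅ : ℝ) =
      1 / 4 * g.weylEnergy.toReal + g.sigma2WeylSchoutenIntegral) :
    g.weylEnergy.toReal < 16 * Real.pi ^ 2 * (relEuler ℤ ℤ M ∅ : ℝ) ↔
      1 / 4 * g.weylEnergy.toReal < g.sigma2WeylSchoutenIntegral := by
  constructor <;> intro h <;> nlinarith

variable [SimplyConnectedSpace M]

omit [SecondCountableTopology M] in
/-- **`χ(M) ∈ ℕ`, `χ(M) ≥ 2` — the topological half of hypothesis `hCGB` of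
`changGurskyYang_sphere_four_of_margerin_of_chernGaussBonnet_of_thm14`, PROVED**: if the
Chern–Gauss–Bonnet identity (1.1) holds for a metric `g` on a closed simply connected 4-manifold
`M`, then there is a natural number `χ ≥ 2` with `8π²χ = ¼ (∫|W|² dV).toReal + ∫σ₂(A) dV`, namely
`χ = χ(M) = 2 + b₂(M)` (`exists_nat_relEuler_eq_of_simplyConnectedSpace`: Hurewicz, orientability of
simply connected manifolds, Poincaré duality; Gompf–Stipsicz 1999, §1.2).
[cite: ChangGurskyYang2003, (1.1) p. 111] [cite: GompfStipsicz1999, §1.2] -/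
theorem exists_nat_of_chernGaussBonnet
    (hCGB : 8 * Real.pi ^ 2 * (relEuler ℤ ℤ M ∅ : ℝ) =
      1 / 4 * g.weylEnergy.toReal + g.sigma2WeylSchoutenIntegral) :
    ∃ χ : ℕ, 2 ≤ χ ∧
      8 * Real.pi ^ 2 * χ = 1 / 4 * g.weylEnergy.toReal + g.sigma2WeylSchoutenIntegral := by
  obtain ⟨χ, hχ, hχe⟩ := exists_nat_relEuler_eq_of_simplyConnectedSpace (X := M)
  refine ⟨χ, hχ, ?_⟩
  rw [hχe] at hCGB
  exact_mod_cast hCGB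

omit [SecondCountableTopology M] in
/-- **`16π² ≤ ¼∫|W|² dV + ∫σ₂(A) dV` on a closed simply connected 4-manifold**, from the
Chern–Gauss–Bonnet identity (1.1) for `(M, g)` and `χ(M) ≥ 2`
(`two_le_relEuler_of_simplyConnectedSpace`) — the inequality `32π² ≤ 16π² χ(M)` of the vended
special case. [cite: ChangGurskyYang2003, (1.1) p. 111] [cite: GompfStipsicz1999, §1.2] -/
theorem sixteen_pi_sq_le_of_chernGaussBonnet
    (hCGB : 8 * Real.pi ^ 2 * (relEuler ℤ ℤ M ∅ : ℝ) =
      1 / 4 * g.weylEnergy.toReal + g.sigma2WeylSchoutenIntegral) :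
    16 * Real.pi ^ 2 ≤ 1 / 4 * g.weylEnergy.toReal + g.sigma2WeylSchoutenIntegral := by
  have h2 : (2 : ℝ) ≤ (relEuler ℤ ℤ M ∅ : ℝ) := by
    exact_mod_cast two_le_relEuler_of_simplyConnectedSpace (X := M)
  have hπ : 0 < Real.pi ^ 2 := by positivity
  rw [← hCGB]
  nlinarith

omit [SecondCountableTopology M] in
/-- **(0.3) with `32π²` gives (1.2) on a closed simply connected 4-manifold** (Chang–Gursky–Yang
2003, §2, p. 121, in the vended special case of `changGurskyYang_sphere_four`:
`∫|W|² < 32π² ≤ 16π² χ(M)`, so `¼∫|W|² < ∫σ₂(A)`), from the Chern–Gauss–Bonnet identity (1.1)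
for the Riemannian metric `g` (its Weyl energy is finite, `weylEnergy_lt_top`).
[cite: ChangGurskyYang2003, §2, p. 121] -/
theorem quarter_weylEnergy_lt_of_chernGaussBonnet (hg : g.IsRiemannian)
    (hCGB : 8 * Real.pi ^ 2 * (relEuler ℤ ℤ M ∅ : ℝ) =
      1 / 4 * g.weylEnergy.toReal + g.sigma2WeylSchoutenIntegral)
    (hW : g.weylEnergy < ENNReal.ofReal (32 * Real.pi ^ 2)) :
    1 / 4 * g.weylEnergy.toReal < g.sigma2WeylSchoutenIntegral := by
  have hWr : g.weylEnergy.toReal < 32 * Real.pi ^ 2 :=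
    (ENNReal.lt_ofReal_iff_toReal_lt (g.weylEnergy_lt_top hg).ne).1 hW
  have h16 := sixteen_pi_sq_le_of_chernGaussBonnet g hCGB
  linarith

end EulerStep

/-! ### Theorem A as printed, and the vended special case, from Chern–Gauss–Bonnet, Margerin and Thm. 1.4 -/

section ReductionClassical

/-- **Chang–Gursky–Yang 2003, THEOREM A AS PRINTED, from its three inputs** (p. 107: "Let
`(M⁴, g)` be a smooth, closed four-manifold for which (i) the Yamabe invariant `Y(M⁴, g) > 0`, and
(ii) the Weyl curvature satisfies `∫_{M⁴} |W|² dvol < 16π² χ(M⁴)` (0.3). Then `M⁴` is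
diffeomorphic to either `S⁴` or `ℝP⁴`"), proved as in §2 (p. 121) line by line relative to three
hypotheses, each ONE published theorem stated in the tree's vocabulary:

* `hCGB` — THE CHERN–GAUSS–BONNET FORMULA (Chang–Gursky–Yang 2003, (1.1), p. 111:
  "`8π² χ(M⁴) = ∫ ¼|W|² dvol + ∫ σ₂(A) dvol`", equivalently (0.4), p. 107, for a smooth closed
  Riemannian four-manifold, `|W|² = W_{ijkl}W^{ijkl}` (Remark 2); Besse 1987, 6.30–6.31 with
  `χ(M) = Σ (−1)^i b_i`; Chern 1944): for every `C^∞` Riemannian metric `g` on a compact Hausdorff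
  second countable `C^∞` 4-manifold `M`, `8π² χ(M) = ¼ (∫|W_g|² dV_g).toReal + ∫σ₂(A_g) dV_g` with
  `χ(M) = relEuler ℤ ℤ M ∅ = Σ_k (−1)^k rank H_k(M; ℤ)` (`weylEnergy`, finite by `weylEnergy_lt_top`;
  `sigma2WeylSchoutenIntegral`);
* `hMargerin` — MARGERIN'S WEAK-PINCHING SPHERE THEOREM (Margerin 1998, Thm. 1, p. 21, with p. 22
  and Part I, p. 25: a compact [connected] 4-manifold with a metric of positive scalar curvature and
  weak pinching `WP < 1/6` "is diffeomorphic to the (standard) 4-sphere, if it is orientable, or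
  else to the standard `ℤ₂`-quotient"; `WP = (|W|² + 2|E|²)/R²`, Chang–Gursky–Yang 2003, (0.2),
  the function `weakPinching`; conclusion recorded as the disjunction, `IsRealProjectiveSpace 4 M`
  being the standard `ℝP⁴`);
* `hThm14` — THEOREM 1.4 WITH `α = 1` (Chang–Gursky–Yang 2003, pp. 112–113, from [CGY1]): for a
  smooth closed Riemannian `(M, g₀)` with `Y(M,[g₀]) > 0` and `∫σ₂(A₀) dV₀ − ¼∫|W₀|² dV₀ > 0` there
  is a conformal metric `g = e^{2w} g₀` with `σ₂(A_g) − ¼|W_g|² > 0` pointwise.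

Statement: for every closed connected smooth 4-manifold `M` (connectedness is implicit in
"four-manifold … diffeomorphic to `S⁴` or `ℝP⁴`") with a `C^∞` Riemannian metric `g` such that
(i) `Y(M,[g]) > 0` (`yamabeConstant`, Remark 1 / Lee–Parker (1.5)) and (ii)
`∫|W_g|² dV_g < 16π² χ(M)`, `M` is diffeomorphic to the standard `S⁴` or is a standard `ℝP⁴`.
Proof (§2): "(0.3) is equivalent to (1.2)" by `hCGB` (`weylEnergy_lt_iff_of_chernGaussBonnet`);
Thm. 1.4 gives a conformal `g'` with `¼|W|² < σ₂(A)` pointwise; "rearranging terms"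
(`weakPinching_lt_of_sigma2WeylSchouten_gt`) gives `WP < 1/6` and `R ≠ 0`; "this implies in
particular that `R > 0`" (`scalarCurvature_pos_of_yamabeConstant_pos`, with
`Y(M,[g']) = Y(M,[g]) > 0`, `yamabeConstant_eq_of_isConformalTo`); Margerin's theorem concludes.
[cite: ChangGurskyYang2003, Thm. A and §2, p. 121] [cite: ChangGurskyYang2003, (1.1) p. 111]
[cite: ChangGurskyYang2003, Thm. 1.4] [cite: Margerin1998, Thm. 1] [cite: Besse1987, 6.30–6.31] -/
theorem changGurskyYang_theoremA_of_chernGaussBonnet_of_margerin_of_thm14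
    (hCGB : ∀ (M : Type) [TopologicalSpace M] [T2Space M] [SecondCountableTopology M]
      [ChartedSpace (EuclideanSpace ℝ (Fin 4)) M] [IsManifold (𝓡 4) ∞ M] [CompactSpace M]
      (g : PseudoRiemannianMetric (𝓡 4) ∞ (EuclideanSpace ℝ (Fin 4)) (TangentSpace (𝓡 4) : M → Type _))
      [g.HasLeviCivita], g.IsRiemannian →
      8 * Real.pi ^ 2 * (relEuler ℤ ℤ M ∅ : ℝ) =
        1 / 4 * g.weylEnergy.toReal + g.sigma2WeylSchoutenIntegral)
    (hMargerin : ∀ (M : Type) [TopologicalSpace M] [T2Space M] [SecondCountableTopology M]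
      [ChartedSpace (EuclideanSpace ℝ (Fin 4)) M] [IsManifold (𝓡 4) ∞ M] [CompactSpace M]
      [ConnectedSpace M]
      (g : PseudoRiemannianMetric (𝓡 4) ∞ (EuclideanSpace ℝ (Fin 4)) (TangentSpace (𝓡 4) : M → Type _))
      [g.HasLeviCivita], g.IsRiemannian → (∀ x, 0 < g.scalarCurvature x) →
      (∀ x, g.weakPinching x < 1 / 6) →
      Nonempty (M ≃ₘ⟮𝓡 4, 𝓡 4⟯ Metric.sphere (0 : EuclideanSpace ℝ (Fin 5)) 1) ∨
        IsRealProjectiveSpace 4 M)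
    (hThm14 : ∀ (M : Type) [TopologicalSpace M] [T2Space M] [SecondCountableTopology M]
      [ChartedSpace (EuclideanSpace ℝ (Fin 4)) M] [IsManifold (𝓡 4) ∞ M] [CompactSpace M]
      [MeasurableSpace M] [BorelSpace M]
      (g₀ : PseudoRiemannianMetric (𝓡 4) ∞ (EuclideanSpace ℝ (Fin 4)) (TangentSpace (𝓡 4) : M → Type _))
      [g₀.HasLeviCivita] (hg₀ : g₀.IsRiemannian),
      0 < yamabeConstant (g₀.toContMDiffRiemannianMetric hg₀) →
      1 / 4 * g₀.weylEnergy.toReal < g₀.sigma2WeylSchoutenIntegral →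
      ∃ (g : PseudoRiemannianMetric (𝓡 4) ∞ (EuclideanSpace ℝ (Fin 4)) (TangentSpace (𝓡 4) : M → Type _))
        (_ : g.HasLeviCivita) (hg : g.IsRiemannian),
        IsConformalTo (g.toContMDiffRiemannianMetric hg) (g₀.toContMDiffRiemannianMetric hg₀) ∧
        ∀ x, 1 / 4 * g.weylNormSq x < g.sigma2WeylSchouten x)
    (M : Type) [TopologicalSpace M] [T2Space M] [SecondCountableTopology M]
    [ChartedSpace (EuclideanSpace ℝ (Fin 4)) M] [IsManifold (𝓡 4) ∞ M] [CompactSpace M]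
    [ConnectedSpace M] [MeasurableSpace M] [BorelSpace M]
    (g : PseudoRiemannianMetric (𝓡 4) ∞ (EuclideanSpace ℝ (Fin 4)) (TangentSpace (𝓡 4) : M → Type _))
    [g.HasLeviCivita] (hg : g.IsRiemannian)
    (hY : 0 < yamabeConstant (g.toContMDiffRiemannianMetric hg))
    (hW : g.weylEnergy < ENNReal.ofReal (16 * Real.pi ^ 2 * (relEuler ℤ ℤ M ∅ : ℝ))) :
    Nonempty (M ≃ₘ⟮𝓡 4, 𝓡 4⟯ Metric.sphere (0 : EuclideanSpace ℝ (Fin 5)) 1) ∨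
      IsRealProjectiveSpace 4 M := by
  have hE : Module.finrank ℝ (EuclideanSpace ℝ (Fin 4)) = 4 := finrank_euclideanSpace_fin
  -- (ii): "(0.3) is equivalent to the inequality (1.2)" by Chern–Gauss–Bonnet
  have hWr : g.weylEnergy.toReal < 16 * Real.pi ^ 2 * (relEuler ℤ ℤ M ∅ : ℝ) :=
    (ENNReal.lt_ofReal_iff_toReal_lt (g.weylEnergy_lt_top hg).ne).1 hW
  have h12 : 1 / 4 * g.weylEnergy.toReal < g.sigma2WeylSchoutenIntegral :=
    (weylEnergy_lt_iff_of_chernGaussBonnet g (hCGB M g hg)).1 hWr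
  -- §1, Thm. 1.4 (α = 1): a conformal metric with `σ₂(A) - ¼|W|² > 0` pointwise
  obtain ⟨g', _, hg'R, hconf, hpt⟩ := hThm14 M g hg hY h12
  have hpos' : ∀ (x : M) (v : TangentSpace (𝓡 4) x), v ≠ 0 → 0 < g'.val x v v :=
    fun x v hv ↦ hg'R x v hv
  -- "Rearranging terms": `WP < 1/6` and `R ≠ 0` pointwise; "in particular `R > 0`" by `Y > 0`
  have hne : ∀ x, g'.scalarCurvature x ≠ 0 := fun x ↦
    g'.scalarCurvature_ne_zero_of_sigma2WeylSchouten_gt (WithTop.coe_le_coe.mpr le_top) hE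
      (hpos' x) (hpt x)
  have hY' : 0 < yamabeConstant (g'.toContMDiffRiemannianMetric hg'R) := by
    rwa [yamabeConstant_eq_of_isConformalTo hconf]
  have hscal' : ∀ x, 0 < g'.scalarCurvature x :=
    g'.scalarCurvature_pos_of_yamabeConstant_pos hg'R hY' hne
  have hWP : ∀ x, g'.weakPinching x < 1 / 6 := fun x ↦
    g'.weakPinching_lt_of_sigma2WeylSchouten_gt (WithTop.coe_le_coe.mpr le_top) hE (hpos' x) (hpt x)
  -- Margerin: `S⁴` or `ℝP⁴`
  exact hMargerin M g' hg'R hscal' hWP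

/-- **The vended special case IS a special case of Theorem A as printed — with every auxiliary
classical input PROVED.** If Theorem A holds in the printed form (hypothesis `hA`: closed connected
smooth 4-manifold, `C^∞` Riemannian `g`, `Y(M,[g]) > 0` and `∫|W|² dV < 16π² χ(M)` imply `S⁴` or
standard `ℝP⁴`; `χ(M) = relEuler ℤ ℤ M ∅`), then `changGurskyYang_sphere_four` holds. The three
classical facts used by the fact file's docstring ("Why this is (no more than) Theorem A") are all
theorems of the tree: (1) `scal_g > 0` on a closed connected 4-manifold gives `Y(M,[g]) > 0`
(`yamabeConstant_pos_of_scalarCurvature_pos`, Aubin 1982, §6.5 — `YamabePositivity.lean`);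
(2) `χ(M) ≥ 2` for closed simply connected 4-manifolds, so `∫|W|² < 32π² ≤ 16π² χ(M)`
(`two_le_relEuler_of_simplyConnectedSpace`, `SimplyConnectedEulerCharacteristic.lean`);
(3) `π₁(ℝP⁴) ≠ 1` (`IsRealProjectiveSpace.not_simplyConnectedSpace`). In particular nothing
stronger than Theorem A is vendored by `changGurskyYang_sphere_four`.
[cite: ChangGurskyYang2003, Thm. A] [cite: Aubin1982, Ch. 6, §6.5] [cite: GompfStipsicz1999, §1.2] -/
theorem changGurskyYang_sphere_four_of_theoremA
    (hA : ∀ (M : Type) [TopologicalSpace M] [T2Space M] [SecondCountableTopology M]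
      [ChartedSpace (EuclideanSpace ℝ (Fin 4)) M] [IsManifold (𝓡 4) ∞ M] [CompactSpace M]
      [ConnectedSpace M] [MeasurableSpace M] [BorelSpace M]
      (g : PseudoRiemannianMetric (𝓡 4) ∞ (EuclideanSpace ℝ (Fin 4)) (TangentSpace (𝓡 4) : M → Type _))
      [g.HasLeviCivita] (hg : g.IsRiemannian),
      0 < yamabeConstant (g.toContMDiffRiemannianMetric hg) →
      g.weylEnergy < ENNReal.ofReal (16 * Real.pi ^ 2 * (relEuler ℤ ℤ M ∅ : ℝ)) →
      Nonempty (M ≃ₘ⟮𝓡 4, 𝓡 4⟯ Metric.sphere (0 : EuclideanSpace ℝ (Fin 5)) 1) ∨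
        IsRealProjectiveSpace 4 M) :
    changGurskyYang_sphere_four := by
  intro M _ _ _ _ _ _ _ hg
  obtain ⟨g, _, hgR, hscal, hW⟩ := hg
  letI : MeasurableSpace M := borel M
  haveI : BorelSpace M := ⟨rfl⟩
  -- (1): `Y(M,[g]) > 0` since `scal_g > 0`
  have hY : 0 < yamabeConstant (g.toContMDiffRiemannianMetric hgR) :=
    yamabeConstant_pos_of_scalarCurvature_pos g hgR hscal
  -- (2): `∫|W|² < 32π² ≤ 16π² χ(M)` since `χ(M) ≥ 2`
  have h2 : (2 : ℝ) ≤ (relEuler ℤ ℤ M ∅ : ℝ) := by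
    exact_mod_cast two_le_relEuler_of_simplyConnectedSpace (X := M)
  have hW' : g.weylEnergy < ENNReal.ofReal (16 * Real.pi ^ 2 * (relEuler ℤ ℤ M ∅ : ℝ)) := by
    refine lt_of_lt_of_le hW (ENNReal.ofReal_le_ofReal ?_)
    have hπ : 0 < Real.pi ^ 2 := by positivity
    nlinarith
  -- Theorem A, and (3): `π₁(ℝP⁴) ≠ 1` excludes `ℝP⁴`
  rcases hA M g hgR hY hW' with h | h
  · exact h
  · exact absurd ‹SimplyConnectedSpace M› (h.not_simplyConnectedSpace (by norm_num))

/-- **Chang–Gursky–Yang 2003, Theorem A (vended special case `changGurskyYang_sphere_four`) from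
the Chern–Gauss–Bonnet formula, Margerin's theorem and Thm. 1.4, each stated verbatim** —
refining `changGurskyYang_sphere_four_of_margerin_of_chernGaussBonnet_of_thm14`
(`ChangGurskyYangProofs.lean`), whose hypothesis `hCGB` ("`∃ χ : ℕ, χ ≥ 2, 8π²χ = ¼∫|W|² + ∫σ₂(A)`"
on simply connected closed `M`) is now split into the THEOREM `χ(M) = 2 + b₂(M) ≥ 2`
(`two_le_relEuler_of_simplyConnectedSpace`) and the classical formula (1.1) over
`χ(M) = relEuler ℤ ℤ M ∅` (hypotheses as in
`changGurskyYang_theoremA_of_chernGaussBonnet_of_margerin_of_thm14`). Proof: Theorem A as printed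
(`changGurskyYang_theoremA_of_chernGaussBonnet_of_margerin_of_thm14`) and
`changGurskyYang_sphere_four_of_theoremA`. The three hypotheses are deep published theorems that are
not named facts of the tree: the exact remaining proof debt of `changGurskyYang_sphere_four` along
the printed line. [cite: ChangGurskyYang2003, §2, p. 121] [cite: ChangGurskyYang2003, (1.1) p. 111]
[cite: ChangGurskyYang2003, Thm. 1.4] [cite: Margerin1998, Thm. 1] [cite: Besse1987, 6.30–6.31] -/
theorem changGurskyYang_sphere_four_of_chernGaussBonnet_of_margerin_of_thm14
    (hCGB : ∀ (M : Type) [TopologicalSpace M] [T2Space M] [SecondCountableTopology M]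
      [ChartedSpace (EuclideanSpace ℝ (Fin 4)) M] [IsManifold (𝓡 4) ∞ M] [CompactSpace M]
      (g : PseudoRiemannianMetric (𝓡 4) ∞ (EuclideanSpace ℝ (Fin 4)) (TangentSpace (𝓡 4) : M → Type _))
      [g.HasLeviCivita], g.IsRiemannian →
      8 * Real.pi ^ 2 * (relEuler ℤ ℤ M ∅ : ℝ) =
        1 / 4 * g.weylEnergy.toReal + g.sigma2WeylSchoutenIntegral)
    (hMargerin : ∀ (M : Type) [TopologicalSpace M] [T2Space M] [SecondCountableTopology M]
      [ChartedSpace (EuclideanSpace ℝ (Fin 4)) M] [IsManifold (𝓡 4) ∞ M] [CompactSpace M]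
      [ConnectedSpace M]
      (g : PseudoRiemannianMetric (𝓡 4) ∞ (EuclideanSpace ℝ (Fin 4)) (TangentSpace (𝓡 4) : M → Type _))
      [g.HasLeviCivita], g.IsRiemannian → (∀ x, 0 < g.scalarCurvature x) →
      (∀ x, g.weakPinching x < 1 / 6) →
      Nonempty (M ≃ₘ⟮𝓡 4, 𝓡 4⟯ Metric.sphere (0 : EuclideanSpace ℝ (Fin 5)) 1) ∨
        IsRealProjectiveSpace 4 M)
    (hThm14 : ∀ (M : Type) [TopologicalSpace M] [T2Space M] [SecondCountableTopology M]
      [ChartedSpace (EuclideanSpace ℝ (Fin 4)) M] [IsManifold (𝓡 4) ∞ M] [CompactSpace M]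
      [MeasurableSpace M] [BorelSpace M]
      (g₀ : PseudoRiemannianMetric (𝓡 4) ∞ (EuclideanSpace ℝ (Fin 4)) (TangentSpace (𝓡 4) : M → Type _))
      [g₀.HasLeviCivita] (hg₀ : g₀.IsRiemannian),
      0 < yamabeConstant (g₀.toContMDiffRiemannianMetric hg₀) →
      1 / 4 * g₀.weylEnergy.toReal < g₀.sigma2WeylSchoutenIntegral →
      ∃ (g : PseudoRiemannianMetric (𝓡 4) ∞ (EuclideanSpace ℝ (Fin 4)) (TangentSpace (𝓡 4) : M → Type _))
        (_ : g.HasLeviCivita) (hg : g.IsRiemannian),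
        IsConformalTo (g.toContMDiffRiemannianMetric hg) (g₀.toContMDiffRiemannianMetric hg₀) ∧
        ∀ x, 1 / 4 * g.weylNormSq x < g.sigma2WeylSchouten x) :
    changGurskyYang_sphere_four :=
  changGurskyYang_sphere_four_of_theoremA
    (changGurskyYang_theoremA_of_chernGaussBonnet_of_margerin_of_thm14 hCGB hMargerin hThm14)

end ReductionClassical

end Literature.Geometry.Riemannian
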